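import Summits.QuantumFields.BalabanUV.T4Continuum.Spine.NE1p.DressedSmallFieldOnCoresSlotLetters
import Summits.QuantumFields.BalabanUV.T4Continuum.Spine.NE1p.DressedSmallFieldOnCoresSlotFaces

/-!
# T⁴ programme, spine estimate NE1′ (node O3b/H2) — THE SLOT-LETTERS ENDs ON THE TORUS OF THE PAPERS: S30's letter-discharged slot
# ENDs (at the substrate's core letters of record `coreLettersOf A` and at the activity slot of record `(slotsOfRecord …).act`) at
# pv22's `tgeometry 4 N` — NO geometry hypothesis AND NO operator-letter block —, the ϱ-FREE sharp-room-3 form, and the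
# S29 ∘ S30 commuting square in kernel (torus-then-letters = letters-then-torus)

Cell `pub-balaban`, sub-cell `t4`, BINDER-OWNERS row NE1′ (owner lineage t4-ne1p-p1); crew seat `b2b-balaban-t4-ne1p-formalise-leaf-04`
(LEAF PROVER 04, generation 13); crew FACE row (INTENT `CLAIMS.log` 2026-08-20T17:05Z; the row the typer PRE-ANNOUNCED in R-T113 (iii-e):
«S29 re-sockets N0r's ENDs ϱ-free ∕ on the torus with the letter blocks still DISPLAYED; S30 discharges the letter blocks at general `G` —
neither imports the other; if both land, a torus form of S30's END is a later row»).  ADDITIVE — imports crew rows S30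
`Spine/NE1p/DressedSmallFieldOnCoresSlotLetters` (⇒ the owner's N0r `DressedSmallFieldOnCoresSlot` ⇒ N0q ⇒ N0p ⇒ N0o ⇒ N0m; the substrate
cell's `Support/SubstrateGaussianLettersBall`, `Support/SubstrateSlotsOfRecord`, `Support/SubstrateActivities`) and S29
`Spine/NE1p/DressedSmallFieldOnCoresSlotFaces` (⇒ S24 `DressedSmallFieldGeometryFaces`) ONLY — the JOIN of the two sibling rows; THEOREMS
ONLY (+ one `example`; 0 `def`, 0 `def … : Prop`, 0 cite); nothing of S29 ∕ S30 ∕ N0m–N0r ∕ S24–S28 ∕ the substrate ∕ row NE5 restated —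
their declarations are used BY NAME.

WHY THIS FILE.  S30 discharges N0r §3's operator-letter blocks `hm` ∕ `hN` ∕ `hq` at the core letters of record into the substrate's
PRIMITIVE per-factor scalar conditions but keeps a GENERAL `Ge : B13Resummation.Geometry 𝔇 Cube` (clauses at `Ge.κ₀` ∕ `Ge.K₀` ∕ `Ge.ν` ∕
`Ge.c₁`, `hb : r₁·5 ≤ b₅`) and N0m §2's radius binders `hϱ` ∕ `hϱA`; S29 re-sockets N0r's ENDs on pv22's CONSTRUCTED torus geometry but
keeps the letter blocks DISPLAYED.  THIS FILE wires both at once — the S24–S29 §2 pattern verbatim, nothing else: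
* §1 at `𝔇 := tsys 4 N`, `Ge := tgeometry 4 N` (pv22), constants LOCATED AS NUMERALS by N0o `torus_consts` + S24 `K₀_four` BY NAME (ν = 9,
  κ₀ = 64·log 162, c₁ = 64, K₀ = `B12TreeDecay.K₀ 64 8`; print's (2.27) `c = 5` through `b₅ := 5·r₁`): `attachedPart_locE_le_of_coreLettersOf_torus`
  ∕ `muPart_locE_le_of_coreLettersOf_torus` (S30 §2 ONCE BY NAME each) and `attachedPart_locE_le_of_coreLettersOf_printClause_three_torus` (through
  the first at the pencil radius `ϱ⋆ := max 2 (A₀/A₁)`, `hϱ` ∕ `hϱA` ∕ `hsmall` SUPPLIED by N0m §4∕§4b's `two_le_pencilRadius` ∕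
  `intercept_le_pencilRadius_mul` ∕ `pencilClause_of_printClause_three` BY NAME under a live slope `0 < A₁ ≤ A₀` and
  `h3 : 3·A₀·(e^{5r₁+1}·K₀(64,8)·9·64) ≤ 1` — NO radius binder; `hH` and (B3)'s growth letter READ AT `ϱ⋆`, as in N0m's ϱ-free ENDs).
* §2 one `example` — THE COMMUTING SQUARE IN KERNEL: §1's `attachedPart_locE_le_of_coreLettersOf_torus` IS S29 §2's
  `attachedPart_locE_le_of_actOfLetters_torus` at `ℓ := coreLettersOf D P Op 𝒵 dom Jc V mI A` with S30 §1's three block producers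
  `margin_pos` ∕ `hN_coreLettersOf` ∕ `hq_coreLettersOf` BY NAME (torus-then-letters = letters-then-torus) — NO new inequality.
* §3 the same for S30 §3's two ENDs at the ACTIVITY SLOT OF RECORD `(slotsOfRecord …).act`: `attachedPart_locE_le_slotsOfRecord_act_torus`
  ∕ `muPart_locE_le_slotsOfRecord_act_torus` (ONCE BY NAME each; class centre `ctr` GENERAL exactly as in S30 — its identification with run
  B's operator datum of record and with NE1′'s window classes is the substrate's ∕ the owner's READING, NOT asserted).
Conclusions LITERALLY the crew's ONE torus currency: attached parts `≤ 4·(e·9·64·K₀(64,8)²)·A₁·e^{−r₁·torusTreeLen X₀}` (S25∕S27∕S29's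
right-hand side), μ-parts `≤ e·9·64·K₀(64,8)²·A′·e^{−r₁·torusTreeLen X₀}·μ₀/(μ₁ − μ₀)` (S24∕S27's).
CENSUS vs S30 §2∕§3 (binders): MINUS = [`𝔇`, `Cube`, `Ge`, `b₅`, `hb`] (ϱ-free form: also [`ϱ`, `hϱ`, `hϱA`, `hsmall`] ↦ [`hA₁ : 0 < A₁`,
`hle`, `h3`]); PLUS = [`N`, `[NeZero N]`]; rest IDENTICAL.
WHAT STAYS DISPLAYED (binders, by name; NOTHING instantiated on Bałaban's densities): `hroom`, `0 ≤ R′ k`; per factor the substrate's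
primitive letter conditions, the CENTRE CONDITIONS `hctr` and the radius smallnesses `hbud` ∕ `hmq` (S30's currency — (B1a)'s operator-letter
half is KERNEL only RELATIVE TO these, exactly as S30 says); `hO` ∕ `hH`; (B1b)'s residue `terms` ∕ `emb` ∕ `hscale`; (B3) = `hM3` on S30's
EXPLICIT letters — G-ne9p2-5, UNPRINTED, shared with NE9, a BINDER, never `[cite:`-tagged; the located clauses «κ large»
`r₁ + 2·(64·log 162) + 2 ≤ R` and «ε₁ small» in the SHAPES `(A₀ + ϱA₁)·E ≤ 1` ∕ `3·A₀·E ≤ 1` ∕ `A′·E ≤ 1`, `E = e^{5r₁+1}·K₀(64,8)·9·64` ((B5):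
the SHAPES and the factor `3` are the owner's arithmetic consumed BY NAME; their standing against print's NUMBERS is untouched).  (B4) is
discharged BY NAME on pv22's CONSTRUCTED torus geometry (pv22's READING of 𝐃_{k+1} ∕ d_{k+1}, DIVERGENCE D-pv22.3, not asserted here);
no wall item moves; the wall line v1.7 (T4-DAG v43) does NOT move; R-t4r2-Q2 NOT met thereby.
HONEST FRAMING.  Kernel bookkeeping — by-name composition of S30 (letters) with the S24–S29 torus pattern; cores ∕ letters ∕ `actOfLetters`
∕ `slotsOfRecord` are the cell's typed FORMAT of (2.14) and the substrate's slot of record, NOT Bałaban's functions; which tables realise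
Bałaban's C^{(k)}(Z₀,σ), Γ_k of [Balaban1988RGII] (2.14) p. 15 is the substrate's DISPLAYED identification, NOT claimed; printed loci ((2.14)
p. 15, (2.18) p. 16, (1.26) p. 8, (2.27) ∕ (2.30) p. 18, (2.38) p. 20; [Balaban1987RGI] p. 251, p. 257) are TYPE ∕ CONTEXT through the imported
[cite]-tagged Literature modules, re-asserted nowhere; ABSOLUTE RULE honoured ([folklore] kernel lemmas only); no numeral of print.  NE1′ ⇐
the named binders — NOT printed, NOT proved; 0 leaves instantiated on Bałaban's densities; spine PROVED 0∕9; count 9 unchanged.  Rung (B)+1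
on ONE finite four-torus — NOT infinite volume, NOT a mass gap, NOT OS on ℝ⁴, NOT Clay.  HONEST DEPENDENCY: continuum YM on T⁴ ⇐ BetaPertH
∧ nine spine estimates (0/9 proved); BetaPertH ⇐ (D1) ∧ (D4) ∧ CAP+tail; G-an2-4 gates asym, D1 and NE2/3/4.
-/

noncomputable section

namespace Summit.QuantumFields.BalabanUV.T4Continuum.NE1p.DressedSmallFieldOnCoresSlotLettersTorus

open scoped BigOperators Matrix
open Metric Set MeasureTheory
open Literature.MathematicalPhysics.QuantumFieldTheory.Balaban1983to89
open Literature.MathematicalPhysics.QuantumFieldTheory.Balaban1983to89.B13Resummation (locE)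
open Literature.MathematicalPhysics.QuantumFieldTheory.Balaban1983to89.B5Prop11Lower (nsq)
open Literature.MathematicalPhysics.QuantumFieldTheory.Balaban1983to89.TreeLengthTorus (tsys torusTreeLen)
open Literature.MathematicalPhysics.QuantumFieldTheory.Balaban1983to89.TreeLengthTorusGeometry (TTouch tgeometry)
open Literature.MathematicalPhysics.QuantumFieldTheory.Balaban1983to89.B12TreeDecay (K₀ K₀_pos)
open Summit.QuantumFields.BalabanUV.T4Continuum.B13OpDatum (OpDatum)
open Summit.QuantumFields.BalabanUV.T4Continuum.B13HistMeasurable (MeasPotFrame B13HistM)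
open Summit.QuantumFields.BalabanUV.T4Continuum.SubstrateTwoRunsDriven (DrivenRuns)
open Summit.QuantumFields.BalabanUV.T4Continuum.SubstrateActivities (coreOf actOfLetters)
open Summit.QuantumFields.BalabanUV.T4Continuum.SubstrateGaussianLetters (gaussC linForm)
open Summit.QuantumFields.BalabanUV.T4Continuum.SubstrateGaussianLettersBall (detBudget)
open Summit.QuantumFields.BalabanUV.T4Continuum.SubstrateSlotsOfRecord (ActLetters coreLettersOf SpeciesRec SlotLetters slotsOfRecord)
open Summit.QuantumFields.BalabanUV.T4Continuum.NE1p.DressedSmallFieldOnCoresSlotLetters (margin_pos hN_coreLettersOf hq_coreLettersOf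
  attachedPart_locE_le_of_coreLettersOf muPart_locE_le_of_coreLettersOf attachedPart_locE_le_slotsOfRecord_act muPart_locE_le_slotsOfRecord_act)
open Summit.QuantumFields.BalabanUV.T4Continuum.NE1p.DressedSmallFieldOnCoresSlotFaces (attachedPart_locE_le_of_actOfLetters_torus)
open Summit.QuantumFields.BalabanUV.T4Continuum.NE1p.DressedSmallFieldInduction (two_le_pencilRadius intercept_le_pencilRadius_mul
  pencilClause_of_printClause_three)
open Summit.QuantumFields.BalabanUV.T4Continuum.NE1p.DressedSmallFieldGeometry (torus_consts)
open Summit.QuantumFields.BalabanUV.T4Continuum.NE1p.DressedSmallFieldGeometryFaces (K₀_four)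

/- ELABORATION NOTE (instance hygiene, no mathematics).  The crew's torus statements (S24–S29) elaborate `DecidableEq` of the torus
domains inside `locE TTouch …` CLASSICALLY (`open Classical in`; no such instance in their import cones), as do the owner's ∕ S30's
general-`G` ENDs for `D.Dom`.  The substrate's `Support/B13Carriers` — imported here through S30 — registers the global instance
`TwoRuns.instDecidableEqTDom`, under which the bare text `locE (TTouch …) …` would put `Dom := TDom 4 N` with THAT instance (propositionally,
not definitionally, equal to the classical one) and stop being the by-name specialisation of S29's ∕ S30's ENDs.  Each conclusion below
therefore pins `locE (Dom := (tsys 4 N).Dom) …` (instance search on the un-unfolded `(tsys 4 N).Dom` is classical in every cone): the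
statements PRINT exactly as S29's (`locE TTouch (fun Z => ↑Z) … ↑X₀`) and are closed by S29's ∕ S30's ENDs BY NAME with no cast. -/

variable {G : Type} [GaugeGroup G] (D : DrivenRuns G) (P : MeasPotFrame D.carriers) {N : ℕ} [NeZero N]

/-! ## §1 S30 §2's two ENDs at `coreLettersOf A` ON THE TORUS `tgeometry 4 N` — no geometry hypothesis, no operator-letter block -/

section CoreLettersOf

variable (Op : Type) [NormedAddCommGroup Op] [NormedSpace ℂ Op] {J : Type}
  (𝒵 : D.carriers.Dom → J → Type) [∀ Z j, Fintype (𝒵 Z j)] (dom : ∀ Z j, 𝒵 Z j → D.carriers.Dom)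
  (Jc : D.carriers.Dom → J → Type) [∀ Z j, Fintype (Jc Z j)]
  (V : D.carriers.Dom → J → Type) [∀ Z j, NormedAddCommGroup (V Z j)] [∀ Z j, InnerProductSpace ℝ (V Z j)]
  [∀ Z j, MeasurableSpace (V Z j)] [∀ Z j, BorelSpace (V Z j)] [∀ Z j, FiniteDimensional ℝ (V Z j)]
  (mI : D.carriers.Dom → J → Type) [∀ Z j, Fintype (mI Z j)] [∀ Z j, DecidableEq (mI Z j)]

open Classical in
/-- **THE ATTACHED PART OF THE SLOT ACTIVITIES AT THE CORE LETTERS OF RECORD, ON THE TORUS** (kernel; S30 §2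
`attachedPart_locE_le_of_coreLettersOf` ONCE BY NAME at `𝔇 := tsys 4 N`, `Ge := tgeometry 4 N`, `b₅ := 5·r₁`, constants located by
N0o `torus_consts` + S24 `K₀_four`): binders = S30's with the geometry GONE (room, `0 ≤ R′`, the substrate's primitive per-factor letter
conditions, the CENTRE CONDITIONS, `hbud` ∕ `hmq`, class radii, `terms` ∕ `emb` ∕ `hscale`, the LOCATED clauses, (B3) `hM3` on S30's explicit
letters with `Z.1 ⊆ X₀.1` and `torusTreeLen`, N0m's `hϱ` ∕ `hϱA`); bound `≤ 4·(e·9·64·K₀(64,8)²)·A₁·e^{−r₁·torusTreeLen X₀}` = S29 §2's. [folklore] -/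
theorem attachedPart_locE_le_of_coreLettersOf_torus {W : Set (ℕ → ℝ)} {ctr : ℕ → (ℕ → ℝ) → D.carriers.BgB → Op × B13HistM P}
    {ROp RHist R' : ℕ → ℝ} (A : ∀ Z j, ActLetters D P Op 𝒵 dom Jc V mI Z j) {β₀ ϑ d₀ γ : D.carriers.Dom → J → ℝ}
    (hroom : ∀ k, ROp k < R' k) (hR' : ∀ k, 0 ≤ R' k) (hbase : ∀ Z j ii jj, Measurable fun a => (A Z j).base a ii jj)
    (hrdm : ∀ Z j ii jj (o' : Op), Measurable fun a => (A Z j).rd a ii jj o')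
    (hβ₀ : ∀ Z j, 0 ≤ β₀ Z j) (hd₀ : ∀ Z j, 0 < d₀ Z j) (hrd : ∀ Z j a ii jj, ‖(A Z j).rd a ii jj‖ ≤ ϑ Z j)
    (hctr : ∀ k, ∀ g ∈ W, ∀ (U : D.carriers.BgB) (Z : D.carriers.Dom) (j : J) (a : (Jc Z j ⊕ 𝒵 Z j) → ℝ × ℝ),
      (∀ ii jj, ‖linForm (A Z j).base (A Z j).rd (ctr k g U).1 a ii jj‖ ≤ β₀ Z j) ∧
      ((linForm (A Z j).base (A Z j).rd (ctr k g U).1 a).det).im = 0 ∧ d₀ Z j ≤ ((linForm (A Z j).base (A Z j).rd (ctr k g U).1 a).det).re ∧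
      (∀ x : mI Z j → ℂ, γ Z j * nsq x ≤ (star x ⬝ᵥ (linForm (A Z j).base (A Z j).rd (ctr k g U).1 a *ᵥ x)).re))
    (hbud : ∀ k Z j, detBudget (Fintype.card (mI Z j)) (β₀ Z j) (ϑ Z j) (R' k) < d₀ Z j)
    (hmq : ∀ k Z j, Fintype.card (mI Z j) * ϑ Z j * R' k < γ Z j)
    {k : ℕ} {g : ℕ → ℝ} (hg : g ∈ W) {U : D.carriers.BgB} {o : Op} {h₀ w : B13HistM P} {ϱ : ℝ}
    (hO : ‖o - (ctr k g U).1‖ ≤ ROp k) (hH : ‖h₀ - (ctr k g U).2‖ + ϱ * ‖w‖ ≤ RHist k)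
    {emb : (tsys 4 N).Dom → D.carriers.Dom} (hscale : ∀ Z, D.carriers.scale (emb Z) = k)
    (terms : (tsys 4 N).Dom → Finset (D.carriers.Dom × J))
    {A₀ A₁ R r₁ : ℝ} (X₀ : (tsys 4 N).Dom) (hA₀ : 0 ≤ A₀) (hA₁ : 0 ≤ A₁) (hr₁ : 0 ≤ r₁)
    (hrate : r₁ + 2 * (64 * Real.log 162) + 2 ≤ R)
    (hsmall : (A₀ + ϱ * A₁) * Real.exp (5 * r₁ + 1) * K₀ 64 8 * 9 * 64 ≤ 1)
    (hM3 : ∀ Z : (tsys 4 N).Dom, Z.1 ⊆ X₀.1 →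
      ∑ p ∈ terms Z, (coreOf P Op 𝒵 dom Jc V (coreLettersOf D P Op 𝒵 dom Jc V mI A) p.1 p.2).lam.real univ *
          ((coreOf P Op 𝒵 dom Jc V (coreLettersOf D P Op 𝒵 dom Jc V mI A) p.1 p.2).wB *
              (gaussC (mI p.1 p.2) * Real.sqrt (max 1 ((Fintype.card (mI p.1 p.2)).factorial *
                β₀ p.1 p.2 ^ Fintype.card (mI p.1 p.2) + d₀ p.1 p.2))) * Real.exp 0) *
          (Real.pi / ((γ p.1 p.2 - Fintype.card (mI p.1 p.2) * ϑ p.1 p.2 * R' k) / 2 / 2)) ^ (Module.finrank ℝ (V p.1 p.2) / 2 : ℝ) *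
        Real.exp ((coreOf P Op 𝒵 dom Jc V (coreLettersOf D P Op 𝒵 dom Jc V mI A) p.1 p.2).N₁ * (‖h₀‖ + ϱ * ‖w‖)) ≤
        (A₀ + ϱ * A₁) * Real.exp (-(R * torusTreeLen Z.1)))
    (hϱ : 2 ≤ ϱ) (hϱA : A₀ ≤ ϱ * A₁) :
    ‖locE (Dom := (tsys 4 N).Dom) (TTouch (d := 4) (N := N)) (fun Z : (tsys 4 N).Dom => Z.1) (fun Z => ∑ p ∈ terms Z,
          actOfLetters P Op 𝒵 dom Jc V (coreLettersOf D P Op 𝒵 dom Jc V mI A) p.1 p.2 o (h₀ + w)) X₀.1 -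
        locE (Dom := (tsys 4 N).Dom) (TTouch (d := 4) (N := N)) (fun Z : (tsys 4 N).Dom => Z.1) (fun Z => ∑ p ∈ terms Z,
          actOfLetters P Op 𝒵 dom Jc V (coreLettersOf D P Op 𝒵 dom Jc V mI A) p.1 p.2 o h₀) X₀.1‖ ≤
      4 * (Real.exp 1 * 9 * 64 * K₀ 64 8 ^ 2) * A₁ * Real.exp (-(r₁ * torusTreeLen X₀.1)) := by
  obtain ⟨hν, hκ, hc⟩ := torus_consts N
  have h := attachedPart_locE_le_of_coreLettersOf D P Op 𝒵 dom Jc V mI (tsys 4 N) (tgeometry 4 N) A hroom hR' hbase hrdm hβ₀ hd₀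
    hrd hctr hbud hmq hg hO hH hscale terms (R := R) (b₅ := 5 * r₁) (X₀ := X₀) hA₀ hA₁ hr₁ (le_of_eq (by ring))
    (by rw [hκ]; exact hrate) (by rw [K₀_four, hν, hc]; exact hsmall) hM3 hϱ hϱA
  rw [hν, hc, K₀_four] at h
  exact h

open Classical in
/-- **THE μ-PART OF THE SAME, ON THE TORUS** (kernel; S30 §2 `muPart_locE_le_of_coreLettersOf` ONCE BY NAME at `tgeometry 4 N`): SOURCE
pencil `h₀ + s • v`, `0 < μ₀ < μ₁`, `‖sμ‖ ≤ μ₀`, (B3) `hM3` at `A′`, `hH` at `μ₁`; bound = S24∕S27's μ-part currency. [folklore] -/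
theorem muPart_locE_le_of_coreLettersOf_torus {W : Set (ℕ → ℝ)} {ctr : ℕ → (ℕ → ℝ) → D.carriers.BgB → Op × B13HistM P}
    {ROp RHist R' : ℕ → ℝ} (A : ∀ Z j, ActLetters D P Op 𝒵 dom Jc V mI Z j) {β₀ ϑ d₀ γ : D.carriers.Dom → J → ℝ}
    (hroom : ∀ k, ROp k < R' k) (hR' : ∀ k, 0 ≤ R' k) (hbase : ∀ Z j ii jj, Measurable fun a => (A Z j).base a ii jj)
    (hrdm : ∀ Z j ii jj (o' : Op), Measurable fun a => (A Z j).rd a ii jj o')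
    (hβ₀ : ∀ Z j, 0 ≤ β₀ Z j) (hd₀ : ∀ Z j, 0 < d₀ Z j) (hrd : ∀ Z j a ii jj, ‖(A Z j).rd a ii jj‖ ≤ ϑ Z j)
    (hctr : ∀ k, ∀ g ∈ W, ∀ (U : D.carriers.BgB) (Z : D.carriers.Dom) (j : J) (a : (Jc Z j ⊕ 𝒵 Z j) → ℝ × ℝ),
      (∀ ii jj, ‖linForm (A Z j).base (A Z j).rd (ctr k g U).1 a ii jj‖ ≤ β₀ Z j) ∧
      ((linForm (A Z j).base (A Z j).rd (ctr k g U).1 a).det).im = 0 ∧ d₀ Z j ≤ ((linForm (A Z j).base (A Z j).rd (ctr k g U).1 a).det).re ∧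
      (∀ x : mI Z j → ℂ, γ Z j * nsq x ≤ (star x ⬝ᵥ (linForm (A Z j).base (A Z j).rd (ctr k g U).1 a *ᵥ x)).re))
    (hbud : ∀ k Z j, detBudget (Fintype.card (mI Z j)) (β₀ Z j) (ϑ Z j) (R' k) < d₀ Z j)
    (hmq : ∀ k Z j, Fintype.card (mI Z j) * ϑ Z j * R' k < γ Z j)
    {k : ℕ} {g : ℕ → ℝ} (hg : g ∈ W) {U : D.carriers.BgB} {o : Op} {h₀ v : B13HistM P} {μ₁ : ℝ}
    (hO : ‖o - (ctr k g U).1‖ ≤ ROp k) (hH : ‖h₀ - (ctr k g U).2‖ + μ₁ * ‖v‖ ≤ RHist k)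
    {emb : (tsys 4 N).Dom → D.carriers.Dom} (hscale : ∀ Z, D.carriers.scale (emb Z) = k)
    (terms : (tsys 4 N).Dom → Finset (D.carriers.Dom × J))
    {A' R r₁ μ₀ : ℝ} (X₀ : (tsys 4 N).Dom) {sμ : ℂ} (hA : 0 ≤ A') (hr₁ : 0 ≤ r₁)
    (hrate : r₁ + 2 * (64 * Real.log 162) + 2 ≤ R) (hsmall : A' * Real.exp (5 * r₁ + 1) * K₀ 64 8 * 9 * 64 ≤ 1)
    (hM3 : ∀ Z : (tsys 4 N).Dom, Z.1 ⊆ X₀.1 →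
      ∑ p ∈ terms Z, (coreOf P Op 𝒵 dom Jc V (coreLettersOf D P Op 𝒵 dom Jc V mI A) p.1 p.2).lam.real univ *
          ((coreOf P Op 𝒵 dom Jc V (coreLettersOf D P Op 𝒵 dom Jc V mI A) p.1 p.2).wB *
              (gaussC (mI p.1 p.2) * Real.sqrt (max 1 ((Fintype.card (mI p.1 p.2)).factorial *
                β₀ p.1 p.2 ^ Fintype.card (mI p.1 p.2) + d₀ p.1 p.2))) * Real.exp 0) *
          (Real.pi / ((γ p.1 p.2 - Fintype.card (mI p.1 p.2) * ϑ p.1 p.2 * R' k) / 2 / 2)) ^ (Module.finrank ℝ (V p.1 p.2) / 2 : ℝ) *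
        Real.exp ((coreOf P Op 𝒵 dom Jc V (coreLettersOf D P Op 𝒵 dom Jc V mI A) p.1 p.2).N₁ * (‖h₀‖ + μ₁ * ‖v‖)) ≤
        A' * Real.exp (-(R * torusTreeLen Z.1)))
    (h0 : 0 < μ₀) (h01 : μ₀ < μ₁) (hμ : ‖sμ‖ ≤ μ₀) :
    ‖locE (Dom := (tsys 4 N).Dom) (TTouch (d := 4) (N := N)) (fun Z : (tsys 4 N).Dom => Z.1) (fun Z => ∑ p ∈ terms Z,
          actOfLetters P Op 𝒵 dom Jc V (coreLettersOf D P Op 𝒵 dom Jc V mI A) p.1 p.2 o (h₀ + sμ • v)) X₀.1 -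
        locE (Dom := (tsys 4 N).Dom) (TTouch (d := 4) (N := N)) (fun Z : (tsys 4 N).Dom => Z.1) (fun Z => ∑ p ∈ terms Z,
          actOfLetters P Op 𝒵 dom Jc V (coreLettersOf D P Op 𝒵 dom Jc V mI A) p.1 p.2 o h₀) X₀.1‖ ≤
      Real.exp 1 * 9 * 64 * K₀ 64 8 ^ 2 * A' * Real.exp (-(r₁ * torusTreeLen X₀.1)) * (μ₀ / (μ₁ - μ₀)) := by
  obtain ⟨hν, hκ, hc⟩ := torus_consts N
  have h := muPart_locE_le_of_coreLettersOf D P Op 𝒵 dom Jc V mI (tsys 4 N) (tgeometry 4 N) A hroom hR' hbase hrdm hβ₀ hd₀ hrd hctr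
    hbud hmq hg hO hH hscale terms (R := R) (b₅ := 5 * r₁) (X₀ := X₀) (sμ := sμ) hA hr₁ (le_of_eq (by ring)) (by rw [hκ]; exact hrate)
    (by rw [K₀_four, hν, hc]; exact hsmall) hM3 h0 h01 hμ
  rw [hν, hc, K₀_four] at h
  exact h

open Classical in
/-- **THE SAME ATTACHED PART, ϱ-FREE — NO GEOMETRY HYPOTHESIS, NO OPERATOR-LETTER BLOCK, NO RADIUS BINDER** (kernel;
`attachedPart_locE_le_of_coreLettersOf_torus` at `ϱ⋆ := max 2 (A₀/A₁)`, its `hϱ` ∕ `hϱA` ∕ `hsmall` SUPPLIED by N0m §4∕§4b's `two_le_pencilRadius` ∕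
`intercept_le_pencilRadius_mul` ∕ `pencilClause_of_printClause_three` BY NAME — S29's pattern): live slope `0 < A₁ ≤ A₀`, «κ large», «ε₁ small
with the sharp factor-3 room» `3·A₀·(e^{5r₁+1}·K₀(64,8)·9·64) ≤ 1`, `hH` and (B3)'s growth letter READ AT `ϱ⋆` ⇒ the same bound. [folklore] -/
theorem attachedPart_locE_le_of_coreLettersOf_printClause_three_torus {W : Set (ℕ → ℝ)}
    {ctr : ℕ → (ℕ → ℝ) → D.carriers.BgB → Op × B13HistM P}
    {ROp RHist R' : ℕ → ℝ} (A : ∀ Z j, ActLetters D P Op 𝒵 dom Jc V mI Z j) {β₀ ϑ d₀ γ : D.carriers.Dom → J → ℝ}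
    (hroom : ∀ k, ROp k < R' k) (hR' : ∀ k, 0 ≤ R' k) (hbase : ∀ Z j ii jj, Measurable fun a => (A Z j).base a ii jj)
    (hrdm : ∀ Z j ii jj (o' : Op), Measurable fun a => (A Z j).rd a ii jj o')
    (hβ₀ : ∀ Z j, 0 ≤ β₀ Z j) (hd₀ : ∀ Z j, 0 < d₀ Z j) (hrd : ∀ Z j a ii jj, ‖(A Z j).rd a ii jj‖ ≤ ϑ Z j)
    (hctr : ∀ k, ∀ g ∈ W, ∀ (U : D.carriers.BgB) (Z : D.carriers.Dom) (j : J) (a : (Jc Z j ⊕ 𝒵 Z j) → ℝ × ℝ),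
      (∀ ii jj, ‖linForm (A Z j).base (A Z j).rd (ctr k g U).1 a ii jj‖ ≤ β₀ Z j) ∧
      ((linForm (A Z j).base (A Z j).rd (ctr k g U).1 a).det).im = 0 ∧ d₀ Z j ≤ ((linForm (A Z j).base (A Z j).rd (ctr k g U).1 a).det).re ∧
      (∀ x : mI Z j → ℂ, γ Z j * nsq x ≤ (star x ⬝ᵥ (linForm (A Z j).base (A Z j).rd (ctr k g U).1 a *ᵥ x)).re))
    (hbud : ∀ k Z j, detBudget (Fintype.card (mI Z j)) (β₀ Z j) (ϑ Z j) (R' k) < d₀ Z j)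
    (hmq : ∀ k Z j, Fintype.card (mI Z j) * ϑ Z j * R' k < γ Z j)
    {k : ℕ} {g : ℕ → ℝ} (hg : g ∈ W) {U : D.carriers.BgB} {o : Op} {h₀ w : B13HistM P} {A₀ A₁ : ℝ}
    (hO : ‖o - (ctr k g U).1‖ ≤ ROp k) (hH : ‖h₀ - (ctr k g U).2‖ + max 2 (A₀ / A₁) * ‖w‖ ≤ RHist k)
    {emb : (tsys 4 N).Dom → D.carriers.Dom} (hscale : ∀ Z, D.carriers.scale (emb Z) = k)
    (terms : (tsys 4 N).Dom → Finset (D.carriers.Dom × J))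
    {R r₁ : ℝ} (X₀ : (tsys 4 N).Dom) (hA₀ : 0 ≤ A₀) (hA₁ : 0 < A₁) (hle : A₁ ≤ A₀) (hr₁ : 0 ≤ r₁)
    (hrate : r₁ + 2 * (64 * Real.log 162) + 2 ≤ R) (h3 : 3 * A₀ * (Real.exp (5 * r₁ + 1) * K₀ 64 8 * 9 * 64) ≤ 1)
    (hM3 : ∀ Z : (tsys 4 N).Dom, Z.1 ⊆ X₀.1 →
      ∑ p ∈ terms Z, (coreOf P Op 𝒵 dom Jc V (coreLettersOf D P Op 𝒵 dom Jc V mI A) p.1 p.2).lam.real univ *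
          ((coreOf P Op 𝒵 dom Jc V (coreLettersOf D P Op 𝒵 dom Jc V mI A) p.1 p.2).wB *
              (gaussC (mI p.1 p.2) * Real.sqrt (max 1 ((Fintype.card (mI p.1 p.2)).factorial *
                β₀ p.1 p.2 ^ Fintype.card (mI p.1 p.2) + d₀ p.1 p.2))) * Real.exp 0) *
          (Real.pi / ((γ p.1 p.2 - Fintype.card (mI p.1 p.2) * ϑ p.1 p.2 * R' k) / 2 / 2)) ^ (Module.finrank ℝ (V p.1 p.2) / 2 : ℝ) *
        Real.exp ((coreOf P Op 𝒵 dom Jc V (coreLettersOf D P Op 𝒵 dom Jc V mI A) p.1 p.2).N₁ *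
          (‖h₀‖ + max 2 (A₀ / A₁) * ‖w‖)) ≤ (A₀ + max 2 (A₀ / A₁) * A₁) * Real.exp (-(R * torusTreeLen Z.1)))
    :
    ‖locE (Dom := (tsys 4 N).Dom) (TTouch (d := 4) (N := N)) (fun Z : (tsys 4 N).Dom => Z.1) (fun Z => ∑ p ∈ terms Z,
          actOfLetters P Op 𝒵 dom Jc V (coreLettersOf D P Op 𝒵 dom Jc V mI A) p.1 p.2 o (h₀ + w)) X₀.1 -
        locE (Dom := (tsys 4 N).Dom) (TTouch (d := 4) (N := N)) (fun Z : (tsys 4 N).Dom => Z.1) (fun Z => ∑ p ∈ terms Z,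
          actOfLetters P Op 𝒵 dom Jc V (coreLettersOf D P Op 𝒵 dom Jc V mI A) p.1 p.2 o h₀) X₀.1‖ ≤
      4 * (Real.exp 1 * 9 * 64 * K₀ 64 8 ^ 2) * A₁ * Real.exp (-(r₁ * torusTreeLen X₀.1)) := by
  have hE : 0 ≤ Real.exp (5 * r₁ + 1) * K₀ 64 8 * 9 * 64 :=
    mul_nonneg (mul_nonneg (mul_nonneg (Real.exp_nonneg _) (K₀_pos 64 8).le) (by norm_num)) (by norm_num)
  have hsmall : (A₀ + max 2 (A₀ / A₁) * A₁) * Real.exp (5 * r₁ + 1) * K₀ 64 8 * 9 * 64 ≤ 1 := by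
    simpa only [mul_assoc] using pencilClause_of_printClause_three hA₁ hle hE h3
  exact attachedPart_locE_le_of_coreLettersOf_torus D P Op 𝒵 dom Jc V mI A hroom hR' hbase hrdm hβ₀ hd₀ hrd hctr hbud hmq hg hO hH
    hscale terms X₀ hA₀ hA₁.le hr₁ hrate hsmall hM3 (two_le_pencilRadius A₀ A₁) (intercept_le_pencilRadius_mul hA₁)

/-! ## §2 Consistency — THE S29 ∘ S30 SQUARE COMMUTES, in kernel (torus-then-letters = letters-then-torus) -/

open Classical in
/-- (E) THE COMMUTING SQUARE: §1's `attachedPart_locE_le_of_coreLettersOf_torus` IS S29 §2's `attachedPart_locE_le_of_actOfLetters_torus`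
(N0r's slot END on the torus, letters DISPLAYED) at `ℓ := coreLettersOf … A` with the blocks `hm` ∕ `hN` ∕ `hq` PRODUCED by S30 §1's `margin_pos`
∕ `hN_coreLettersOf` ∕ `hq_coreLettersOf` BY NAME — S30 §2's own proof transplanted to the torus; NO new inequality. [folklore] -/
example {W : Set (ℕ → ℝ)} {ctr : ℕ → (ℕ → ℝ) → D.carriers.BgB → Op × B13HistM P}
    {ROp RHist R' : ℕ → ℝ} (A : ∀ Z j, ActLetters D P Op 𝒵 dom Jc V mI Z j) {β₀ ϑ d₀ γ : D.carriers.Dom → J → ℝ}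
    (hroom : ∀ k, ROp k < R' k) (hR' : ∀ k, 0 ≤ R' k) (hbase : ∀ Z j ii jj, Measurable fun a => (A Z j).base a ii jj)
    (hrdm : ∀ Z j ii jj (o' : Op), Measurable fun a => (A Z j).rd a ii jj o')
    (hβ₀ : ∀ Z j, 0 ≤ β₀ Z j) (hd₀ : ∀ Z j, 0 < d₀ Z j) (hrd : ∀ Z j a ii jj, ‖(A Z j).rd a ii jj‖ ≤ ϑ Z j)
    (hctr : ∀ k, ∀ g ∈ W, ∀ (U : D.carriers.BgB) (Z : D.carriers.Dom) (j : J) (a : (Jc Z j ⊕ 𝒵 Z j) → ℝ × ℝ),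
      (∀ ii jj, ‖linForm (A Z j).base (A Z j).rd (ctr k g U).1 a ii jj‖ ≤ β₀ Z j) ∧
      ((linForm (A Z j).base (A Z j).rd (ctr k g U).1 a).det).im = 0 ∧ d₀ Z j ≤ ((linForm (A Z j).base (A Z j).rd (ctr k g U).1 a).det).re ∧
      (∀ x : mI Z j → ℂ, γ Z j * nsq x ≤ (star x ⬝ᵥ (linForm (A Z j).base (A Z j).rd (ctr k g U).1 a *ᵥ x)).re))
    (hbud : ∀ k Z j, detBudget (Fintype.card (mI Z j)) (β₀ Z j) (ϑ Z j) (R' k) < d₀ Z j)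
    (hmq : ∀ k Z j, Fintype.card (mI Z j) * ϑ Z j * R' k < γ Z j)
    {k : ℕ} {g : ℕ → ℝ} (hg : g ∈ W) {U : D.carriers.BgB} {o : Op} {h₀ w : B13HistM P} {ϱ : ℝ}
    (hO : ‖o - (ctr k g U).1‖ ≤ ROp k) (hH : ‖h₀ - (ctr k g U).2‖ + ϱ * ‖w‖ ≤ RHist k)
    {emb : (tsys 4 N).Dom → D.carriers.Dom} (hscale : ∀ Z, D.carriers.scale (emb Z) = k)
    (terms : (tsys 4 N).Dom → Finset (D.carriers.Dom × J))
    {A₀ A₁ R r₁ : ℝ} (X₀ : (tsys 4 N).Dom) (hA₀ : 0 ≤ A₀) (hA₁ : 0 ≤ A₁) (hr₁ : 0 ≤ r₁)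
    (hrate : r₁ + 2 * (64 * Real.log 162) + 2 ≤ R)
    (hsmall : (A₀ + ϱ * A₁) * Real.exp (5 * r₁ + 1) * K₀ 64 8 * 9 * 64 ≤ 1)
    (hM3 : ∀ Z : (tsys 4 N).Dom, Z.1 ⊆ X₀.1 →
      ∑ p ∈ terms Z, (coreOf P Op 𝒵 dom Jc V (coreLettersOf D P Op 𝒵 dom Jc V mI A) p.1 p.2).lam.real univ *
          ((coreOf P Op 𝒵 dom Jc V (coreLettersOf D P Op 𝒵 dom Jc V mI A) p.1 p.2).wB *
              (gaussC (mI p.1 p.2) * Real.sqrt (max 1 ((Fintype.card (mI p.1 p.2)).factorial *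
                β₀ p.1 p.2 ^ Fintype.card (mI p.1 p.2) + d₀ p.1 p.2))) * Real.exp 0) *
          (Real.pi / ((γ p.1 p.2 - Fintype.card (mI p.1 p.2) * ϑ p.1 p.2 * R' k) / 2 / 2)) ^ (Module.finrank ℝ (V p.1 p.2) / 2 : ℝ) *
        Real.exp ((coreOf P Op 𝒵 dom Jc V (coreLettersOf D P Op 𝒵 dom Jc V mI A) p.1 p.2).N₁ * (‖h₀‖ + ϱ * ‖w‖)) ≤
        (A₀ + ϱ * A₁) * Real.exp (-(R * torusTreeLen Z.1)))
    (hϱ : 2 ≤ ϱ) (hϱA : A₀ ≤ ϱ * A₁) :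
    ‖locE (Dom := (tsys 4 N).Dom) (TTouch (d := 4) (N := N)) (fun Z : (tsys 4 N).Dom => Z.1) (fun Z => ∑ p ∈ terms Z,
          actOfLetters P Op 𝒵 dom Jc V (coreLettersOf D P Op 𝒵 dom Jc V mI A) p.1 p.2 o (h₀ + w)) X₀.1 -
        locE (Dom := (tsys 4 N).Dom) (TTouch (d := 4) (N := N)) (fun Z : (tsys 4 N).Dom => Z.1) (fun Z => ∑ p ∈ terms Z,
          actOfLetters P Op 𝒵 dom Jc V (coreLettersOf D P Op 𝒵 dom Jc V mI A) p.1 p.2 o h₀) X₀.1‖ ≤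
      4 * (Real.exp 1 * 9 * 64 * K₀ 64 8 ^ 2) * A₁ * Real.exp (-(r₁ * torusTreeLen X₀.1)) :=
  attachedPart_locE_le_of_actOfLetters_torus P Op 𝒵 dom Jc V (coreLettersOf D P Op 𝒵 dom Jc V mI A)
    (mq := fun k p _ => (γ p.1 p.2 - Fintype.card (mI p.1 p.2) * ϑ p.1 p.2 * R' k) / 2) (bq := fun _ _ _ => 0)
    (N₀ := fun _ p _ => gaussC (mI p.1 p.2) *
      Real.sqrt (max 1 ((Fintype.card (mI p.1 p.2)).factorial * β₀ p.1 p.2 ^ Fintype.card (mI p.1 p.2) + d₀ p.1 p.2)))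
    hroom (margin_pos D mI hmq) (hN_coreLettersOf D P Op 𝒵 dom Jc V mI A hR' hbase hrdm hβ₀ hd₀ hrd hctr hbud)
    (hq_coreLettersOf D P Op 𝒵 dom Jc V mI A hbase hrdm hrd hctr) hg hO hH hscale terms X₀ hA₀ hA₁ hr₁ hrate hsmall hM3 hϱ hϱA

end CoreLettersOf

/-! ## §3 S30 §3's two ENDs AT THE ACTIVITY SLOT OF RECORD `(slotsOfRecord …).act`, ON THE TORUS -/

section SlotsOfRecord

open Summit.QuantumFields.BalabanUV.T4Continuum.B13StepTermLabels (InnerLabel)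
open Summit.QuantumFields.BalabanUV.T4Continuum.B13InnerData (Bnd)

variable {o : Type} [Fintype o] [DecidableEq o] (ι : G →* Matrix o o ℂ) (c : ℂ) (a : ℝ) (s : ℕ → ℂ)
variable {T ι' S Ω 𝒴 : Type} {IOp : Type*}
  (𝒵 : D.carriers.Dom → InnerLabel D.carriers.Dom (Bnd D.toTwoRuns) → Type) [∀ Z j, Fintype (𝒵 Z j)]
  (dom : ∀ Z j, 𝒵 Z j → D.carriers.Dom)
  (Jc : D.carriers.Dom → InnerLabel D.carriers.Dom (Bnd D.toTwoRuns) → Type) [∀ Z j, Fintype (Jc Z j)]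
  (V : D.carriers.Dom → InnerLabel D.carriers.Dom (Bnd D.toTwoRuns) → Type) [∀ Z j, NormedAddCommGroup (V Z j)]
  [∀ Z j, InnerProductSpace ℝ (V Z j)] [∀ Z j, MeasurableSpace (V Z j)] [∀ Z j, BorelSpace (V Z j)] [∀ Z j, FiniteDimensional ℝ (V Z j)]
  (mI : D.carriers.Dom → InnerLabel D.carriers.Dom (Bnd D.toTwoRuns) → Type) [∀ Z j, Fintype (mI Z j)] [∀ Z j, DecidableEq (mI Z j)]
  (L : SlotLetters D (o := o) (T := T) (ι' := ι') (S := S) (Ω := Ω) (𝒴 := 𝒴) P (IOp := IOp) 𝒵 dom Jc V mI)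

open Classical in
/-- **THE ATTACHED PART OF THE ACTIVITY SLOT OF RECORD, ON THE TORUS** (kernel; S30 §3 `attachedPart_locE_le_slotsOfRecord_act` ONCE BY
NAME at `tgeometry 4 N`): activities LITERALLY `(slotsOfRecord D ι c a s P 𝒵 dom Jc V mI L).act p.1 p.2 op h`; class centre `ctr` GENERAL (its
identification with run B's operator datum of record is the substrate's READING, NOT asserted). [folklore] -/
theorem attachedPart_locE_le_slotsOfRecord_act_torus {W : Set (ℕ → ℝ)}
    {ctr : ℕ → (ℕ → ℝ) → D.carriers.BgB → OpDatum (SpeciesRec D o T ι' Ω 𝒴) × B13HistM P} {ROp RHist R' : ℕ → ℝ}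
    {β₀ ϑ d₀ γ : D.carriers.Dom → InnerLabel D.carriers.Dom (Bnd D.toTwoRuns) → ℝ}
    (hroom : ∀ k, ROp k < R' k) (hR' : ∀ k, 0 ≤ R' k) (hbase : ∀ Z j ii jj, Measurable fun a' => (L.A Z j).base a' ii jj)
    (hrdm : ∀ Z j ii jj (o' : OpDatum (SpeciesRec D o T ι' Ω 𝒴)), Measurable fun a' => (L.A Z j).rd a' ii jj o')
    (hβ₀ : ∀ Z j, 0 ≤ β₀ Z j) (hd₀ : ∀ Z j, 0 < d₀ Z j) (hrd : ∀ Z j a' ii jj, ‖(L.A Z j).rd a' ii jj‖ ≤ ϑ Z j)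
    (hctr : ∀ k, ∀ g ∈ W, ∀ (U : D.carriers.BgB) (Z : D.carriers.Dom) (j : InnerLabel D.carriers.Dom (Bnd D.toTwoRuns))
      (a' : (Jc Z j ⊕ 𝒵 Z j) → ℝ × ℝ),
      (∀ ii jj, ‖linForm (L.A Z j).base (L.A Z j).rd (ctr k g U).1 a' ii jj‖ ≤ β₀ Z j) ∧
      ((linForm (L.A Z j).base (L.A Z j).rd (ctr k g U).1 a').det).im = 0 ∧ d₀ Z j ≤ ((linForm (L.A Z j).base (L.A Z j).rd (ctr k g U).1 a').det).re ∧
      (∀ x : mI Z j → ℂ, γ Z j * nsq x ≤ (star x ⬝ᵥ (linForm (L.A Z j).base (L.A Z j).rd (ctr k g U).1 a' *ᵥ x)).re))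
    (hbud : ∀ k Z j, detBudget (Fintype.card (mI Z j)) (β₀ Z j) (ϑ Z j) (R' k) < d₀ Z j)
    (hmq : ∀ k Z j, Fintype.card (mI Z j) * ϑ Z j * R' k < γ Z j)
    {k : ℕ} {g : ℕ → ℝ} (hg : g ∈ W) {U : D.carriers.BgB} {op : OpDatum (SpeciesRec D o T ι' Ω 𝒴)} {h₀ w : B13HistM P} {ϱ : ℝ}
    (hO : ‖op - (ctr k g U).1‖ ≤ ROp k) (hH : ‖h₀ - (ctr k g U).2‖ + ϱ * ‖w‖ ≤ RHist k)
    {emb : (tsys 4 N).Dom → D.carriers.Dom} (hscale : ∀ Z, D.carriers.scale (emb Z) = k)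
    (terms : (tsys 4 N).Dom → Finset (D.carriers.Dom × InnerLabel D.carriers.Dom (Bnd D.toTwoRuns)))
    {A₀ A₁ R r₁ : ℝ} (X₀ : (tsys 4 N).Dom) (hA₀ : 0 ≤ A₀) (hA₁ : 0 ≤ A₁) (hr₁ : 0 ≤ r₁)
    (hrate : r₁ + 2 * (64 * Real.log 162) + 2 ≤ R)
    (hsmall : (A₀ + ϱ * A₁) * Real.exp (5 * r₁ + 1) * K₀ 64 8 * 9 * 64 ≤ 1)
    (hM3 : ∀ Z : (tsys 4 N).Dom, Z.1 ⊆ X₀.1 →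
      ∑ p ∈ terms Z, (coreOf P (OpDatum (SpeciesRec D o T ι' Ω 𝒴)) 𝒵 dom Jc V
            (coreLettersOf D P (OpDatum (SpeciesRec D o T ι' Ω 𝒴)) 𝒵 dom Jc V mI L.A) p.1 p.2).lam.real univ *
          ((coreOf P (OpDatum (SpeciesRec D o T ι' Ω 𝒴)) 𝒵 dom Jc V
              (coreLettersOf D P (OpDatum (SpeciesRec D o T ι' Ω 𝒴)) 𝒵 dom Jc V mI L.A) p.1 p.2).wB *
              (gaussC (mI p.1 p.2) * Real.sqrt (max 1 ((Fintype.card (mI p.1 p.2)).factorial *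
                β₀ p.1 p.2 ^ Fintype.card (mI p.1 p.2) + d₀ p.1 p.2))) * Real.exp 0) *
          (Real.pi / ((γ p.1 p.2 - Fintype.card (mI p.1 p.2) * ϑ p.1 p.2 * R' k) / 2 / 2)) ^ (Module.finrank ℝ (V p.1 p.2) / 2 : ℝ) *
        Real.exp ((coreOf P (OpDatum (SpeciesRec D o T ι' Ω 𝒴)) 𝒵 dom Jc V
            (coreLettersOf D P (OpDatum (SpeciesRec D o T ι' Ω 𝒴)) 𝒵 dom Jc V mI L.A) p.1 p.2).N₁ * (‖h₀‖ + ϱ * ‖w‖)) ≤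
        (A₀ + ϱ * A₁) * Real.exp (-(R * torusTreeLen Z.1)))
    (hϱ : 2 ≤ ϱ) (hϱA : A₀ ≤ ϱ * A₁) :
    ‖locE (Dom := (tsys 4 N).Dom) (TTouch (d := 4) (N := N)) (fun Z : (tsys 4 N).Dom => Z.1)
          (fun Z => ∑ p ∈ terms Z, (slotsOfRecord D ι c a s P 𝒵 dom Jc V mI L).act p.1 p.2 op (h₀ + w)) X₀.1 -
        locE (Dom := (tsys 4 N).Dom) (TTouch (d := 4) (N := N)) (fun Z : (tsys 4 N).Dom => Z.1)
          (fun Z => ∑ p ∈ terms Z, (slotsOfRecord D ι c a s P 𝒵 dom Jc V mI L).act p.1 p.2 op h₀) X₀.1‖ ≤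
      4 * (Real.exp 1 * 9 * 64 * K₀ 64 8 ^ 2) * A₁ * Real.exp (-(r₁ * torusTreeLen X₀.1)) := by
  obtain ⟨hν, hκ, hc⟩ := torus_consts N
  have h := attachedPart_locE_le_slotsOfRecord_act D P ι c a s 𝒵 dom Jc V mI L (tsys 4 N) (tgeometry 4 N) hroom hR' hbase hrdm hβ₀
    hd₀ hrd hctr hbud hmq hg hO hH hscale terms (R := R) (b₅ := 5 * r₁) (X₀ := X₀) hA₀ hA₁ hr₁ (le_of_eq (by ring))
    (by rw [hκ]; exact hrate) (by rw [K₀_four, hν, hc]; exact hsmall) hM3 hϱ hϱA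
  rw [hν, hc, K₀_four] at h
  exact h

open Classical in
/-- **THE μ-PART OF THE ACTIVITY SLOT OF RECORD, ON THE TORUS** (kernel; S30 §3 `muPart_locE_le_slotsOfRecord_act` ONCE BY NAME at
`tgeometry 4 N`, constants located; source pencil `h₀ + s • v`). [folklore] -/
theorem muPart_locE_le_slotsOfRecord_act_torus {W : Set (ℕ → ℝ)}
    {ctr : ℕ → (ℕ → ℝ) → D.carriers.BgB → OpDatum (SpeciesRec D o T ι' Ω 𝒴) × B13HistM P} {ROp RHist R' : ℕ → ℝ}
    {β₀ ϑ d₀ γ : D.carriers.Dom → InnerLabel D.carriers.Dom (Bnd D.toTwoRuns) → ℝ}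
    (hroom : ∀ k, ROp k < R' k) (hR' : ∀ k, 0 ≤ R' k) (hbase : ∀ Z j ii jj, Measurable fun a' => (L.A Z j).base a' ii jj)
    (hrdm : ∀ Z j ii jj (o' : OpDatum (SpeciesRec D o T ι' Ω 𝒴)), Measurable fun a' => (L.A Z j).rd a' ii jj o')
    (hβ₀ : ∀ Z j, 0 ≤ β₀ Z j) (hd₀ : ∀ Z j, 0 < d₀ Z j) (hrd : ∀ Z j a' ii jj, ‖(L.A Z j).rd a' ii jj‖ ≤ ϑ Z j)
    (hctr : ∀ k, ∀ g ∈ W, ∀ (U : D.carriers.BgB) (Z : D.carriers.Dom) (j : InnerLabel D.carriers.Dom (Bnd D.toTwoRuns))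
      (a' : (Jc Z j ⊕ 𝒵 Z j) → ℝ × ℝ),
      (∀ ii jj, ‖linForm (L.A Z j).base (L.A Z j).rd (ctr k g U).1 a' ii jj‖ ≤ β₀ Z j) ∧
      ((linForm (L.A Z j).base (L.A Z j).rd (ctr k g U).1 a').det).im = 0 ∧ d₀ Z j ≤ ((linForm (L.A Z j).base (L.A Z j).rd (ctr k g U).1 a').det).re ∧
      (∀ x : mI Z j → ℂ, γ Z j * nsq x ≤ (star x ⬝ᵥ (linForm (L.A Z j).base (L.A Z j).rd (ctr k g U).1 a' *ᵥ x)).re))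
    (hbud : ∀ k Z j, detBudget (Fintype.card (mI Z j)) (β₀ Z j) (ϑ Z j) (R' k) < d₀ Z j)
    (hmq : ∀ k Z j, Fintype.card (mI Z j) * ϑ Z j * R' k < γ Z j)
    {k : ℕ} {g : ℕ → ℝ} (hg : g ∈ W) {U : D.carriers.BgB} {op : OpDatum (SpeciesRec D o T ι' Ω 𝒴)} {h₀ v : B13HistM P} {μ₁ : ℝ}
    (hO : ‖op - (ctr k g U).1‖ ≤ ROp k) (hH : ‖h₀ - (ctr k g U).2‖ + μ₁ * ‖v‖ ≤ RHist k)
    {emb : (tsys 4 N).Dom → D.carriers.Dom} (hscale : ∀ Z, D.carriers.scale (emb Z) = k)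
    (terms : (tsys 4 N).Dom → Finset (D.carriers.Dom × InnerLabel D.carriers.Dom (Bnd D.toTwoRuns)))
    {A' R r₁ μ₀ : ℝ} (X₀ : (tsys 4 N).Dom) {sμ : ℂ} (hA : 0 ≤ A') (hr₁ : 0 ≤ r₁)
    (hrate : r₁ + 2 * (64 * Real.log 162) + 2 ≤ R) (hsmall : A' * Real.exp (5 * r₁ + 1) * K₀ 64 8 * 9 * 64 ≤ 1)
    (hM3 : ∀ Z : (tsys 4 N).Dom, Z.1 ⊆ X₀.1 →
      ∑ p ∈ terms Z, (coreOf P (OpDatum (SpeciesRec D o T ι' Ω 𝒴)) 𝒵 dom Jc V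
            (coreLettersOf D P (OpDatum (SpeciesRec D o T ι' Ω 𝒴)) 𝒵 dom Jc V mI L.A) p.1 p.2).lam.real univ *
          ((coreOf P (OpDatum (SpeciesRec D o T ι' Ω 𝒴)) 𝒵 dom Jc V
              (coreLettersOf D P (OpDatum (SpeciesRec D o T ι' Ω 𝒴)) 𝒵 dom Jc V mI L.A) p.1 p.2).wB *
              (gaussC (mI p.1 p.2) * Real.sqrt (max 1 ((Fintype.card (mI p.1 p.2)).factorial *
                β₀ p.1 p.2 ^ Fintype.card (mI p.1 p.2) + d₀ p.1 p.2))) * Real.exp 0) *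
          (Real.pi / ((γ p.1 p.2 - Fintype.card (mI p.1 p.2) * ϑ p.1 p.2 * R' k) / 2 / 2)) ^ (Module.finrank ℝ (V p.1 p.2) / 2 : ℝ) *
        Real.exp ((coreOf P (OpDatum (SpeciesRec D o T ι' Ω 𝒴)) 𝒵 dom Jc V
            (coreLettersOf D P (OpDatum (SpeciesRec D o T ι' Ω 𝒴)) 𝒵 dom Jc V mI L.A) p.1 p.2).N₁ * (‖h₀‖ + μ₁ * ‖v‖)) ≤
        A' * Real.exp (-(R * torusTreeLen Z.1)))
    (h0 : 0 < μ₀) (h01 : μ₀ < μ₁) (hμ : ‖sμ‖ ≤ μ₀) :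
    ‖locE (Dom := (tsys 4 N).Dom) (TTouch (d := 4) (N := N)) (fun Z : (tsys 4 N).Dom => Z.1)
          (fun Z => ∑ p ∈ terms Z, (slotsOfRecord D ι c a s P 𝒵 dom Jc V mI L).act p.1 p.2 op (h₀ + sμ • v)) X₀.1 -
        locE (Dom := (tsys 4 N).Dom) (TTouch (d := 4) (N := N)) (fun Z : (tsys 4 N).Dom => Z.1)
          (fun Z => ∑ p ∈ terms Z, (slotsOfRecord D ι c a s P 𝒵 dom Jc V mI L).act p.1 p.2 op h₀) X₀.1‖ ≤
      Real.exp 1 * 9 * 64 * K₀ 64 8 ^ 2 * A' * Real.exp (-(r₁ * torusTreeLen X₀.1)) * (μ₀ / (μ₁ - μ₀)) := by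
  obtain ⟨hν, hκ, hc⟩ := torus_consts N
  have h := muPart_locE_le_slotsOfRecord_act D P ι c a s 𝒵 dom Jc V mI L (tsys 4 N) (tgeometry 4 N) hroom hR' hbase hrdm hβ₀ hd₀ hrd
    hctr hbud hmq hg hO hH hscale terms (R := R) (b₅ := 5 * r₁) (X₀ := X₀) (sμ := sμ) hA hr₁ (le_of_eq (by ring))
    (by rw [hκ]; exact hrate) (by rw [K₀_four, hν, hc]; exact hsmall) hM3 h0 h01 hμ
  rw [hν, hc, K₀_four] at h
  exact h

end SlotsOfRecord

end Summit.QuantumFields.BalabanUV.T4Continuum.NE1p.DressedSmallFieldOnCoresSlotLettersTorus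

end
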